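import Summits.BirchSwinnertonDyer.BirchSwinnertonDyer.Theses.KimAtThreeKolyvagin
import Summits.BirchSwinnertonDyer.BirchSwinnertonDyer.Theorems.KimAtThreeKolyvaginCertificateDictionary
import HarnessLib

/-!
# Route `KimAtThreeKolyvagin` (rung W2): on the `t = 0` rows the deep cruxes `DeepUpperAtThree` /
# `DeepLowerAtThree` follow from the LEAF plus `ShallowEqDeepAtTorsionFree` (the converse of the
# Assembly on that locus)

Cell `bsd-addord`, seat `bsd-addord-w2-c3` (D-0074 row B6), item `stmt-BirchSwinnertonDyer-19076`.
The route's Assembly reads `DeepLowerAtThree → DeepUpperAtThree → ShallowEqDeepAtTorsionFree → leaf`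
(`KimAtThreeKolyvaginInputs.kimAtThreeRankZeroPUB_of_inputs`), the leaf `N11.KimAtThreeRankZeroPUB`
being Kim's announced rank-`0` length formula at `p = 3` in the ALL-LEVELS currency
(`∂^{(∞)}(δ̃) = kuriharaPartialInfty`) on the rows with `E(ℚ₃)[3] = 0` (`t = 0`). This file records
the converse bookkeeping, so that the tribunal / planner can read the exact excess of the two deep
cruxes over the leaf:

* `deep_conclusions_of_leaf_conclusion_of_shallowLeDeep` (general `p`, one row): the leaf's conclusion
  `∂^{(∞)} = d ∧ ∂⁽⁰⁾ = s + d` together with crux 19077's conclusion `∂^{(∞)}_{deep} ≤ ∂^{(∞)}` give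
  `∂^{(∞)}_{deep} = ∂^{(∞)}` (the other inequality is the tree lemma
  `kuriharaPartialInfty_le_kuriharaPartialDeepInfty`) and hence BOTH deep conclusions
  `s + ∂^{(∞)}_{deep} ≤ ∂⁽⁰⁾` (19076) and `∂⁽⁰⁾ ≤ s + ∂^{(∞)}_{deep}` (19075) at the row;
  `deep_conclusions_iff_leaf_conclusion_of_shallowLeDeep`: granted 19077 at the row, (19075 ∧ 19076) ⟺ leaf.
* `deepUpper_and_deepLower_of_kimAtThreeRankZeroPUB_of_shallowEqDeepAtTorsionFree`: class level —
  `N11.KimAtThreeRankZeroPUB → ShallowEqDeepAtTorsionFree →` (19076 ∧ 19075 on every `t = 0` row).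
* `deepUpper_and_deepLower_of_thm11_OPEN_of_shallowEqDeepAtTorsionFree`: the same from the ANNOUNCED
  record `Kim2025.thm11_kimShaLength_of_integralPeriod_OPEN` (unrefereed claim, carried BY NAME as a
  hypothesis — never a theorem of the tree) via `kimAtThreeRankZeroPUB_of_thm11_OPEN`.

READING. On the `t = 0` locus the three cruxes are EQUIVALENT to {leaf, 19077}: cruxes 19075/19076
carry no strength beyond the leaf there except through 19077; their genuine excess over the leaf is
the `t ≥ 1` rows (no `t`-binder in 19075/19076; memo `kim3/KIM3-PROOF.md` §14 Theorem A-t), where the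
all-levels leaf is silent and `ShallowEqDeepAtTorsionFree` is false by design. Nothing is asserted;
every crux / name is a hypothesis. [cite: Kim2025RefinedTNC, Thm 1.1, Thm 1.2]
[cite: MazurRubin2004, Def. 5.2.11, Thm. 5.2.12 (i)] [cite: Kim2022StructureSelmer, §1.5.1 (PDF p. 7)]
-/

set_option autoImplicit false
-- the Theorems namespace of a single-conjunct summit repeats the summit name by design (D-0017)
set_option linter.dupNamespace false

noncomputable section

open scoped MatrixGroups ModularForm Classical

open CongruenceSubgroup WeierstrassCurve Literature.NumberTheory.EllipticCurves
  Literature.NumberTheory.EllipticCurves.ModularForms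
  Literature.NumberTheory.EllipticCurves.Kim2025

namespace Summit.BirchSwinnertonDyer.BirchSwinnertonDyer.Theorems.KimAtThreeDeepUpperOfLeaf

open Summit.BirchSwinnertonDyer.Rank1Residual.Additive
open Summit.BirchSwinnertonDyer.BirchSwinnertonDyer.Theses.KimAtThreeKolyvagin
open Summit.BirchSwinnertonDyer.BirchSwinnertonDyer.Theorems.KimAtThreeKolyvaginCertificateDictionary

/-! ### §1 One row, general `p` -/

section Row

variable (W : WeierstrassCurve ℚ) [W.IsGloballyMinimal] (p : ℕ) {N : ℕ} (f : CuspForm (Gamma0 N) 2)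

/-- **Leaf + (shallow ≥ deep) ⟹ both deep conclusions at the row.** If `∂^{(∞)}(δ̃) = d` and
`∂⁽⁰⁾(δ̃) = s + d` (the leaf's conclusion at the row, all-levels currency) and
`∂^{(∞)}_{deep}(δ̃) ≤ ∂^{(∞)}(δ̃)` (crux 19077's conclusion at the row), then `∂^{(∞)}_{deep} = d` and
both `s + d ≤ ∂⁽⁰⁾` (crux 19076) and `∂⁽⁰⁾ ≤ s + d` (crux 19075) hold at the row.
[cite: MazurRubin2004, Def. 5.2.11] [cite: Kim2025RefinedTNC, Thm 1.1] -/
theorem deep_conclusions_of_leaf_conclusion_of_shallowLeDeep {s : ℕ}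
    (hleaf : ∃ d : ℕ, kuriharaPartialInfty W p f = d ∧ kuriharaPartial W p f 0 = ((s + d : ℕ) : ℕ∞))
    (hS : kuriharaPartialDeepInfty W p f ≤ kuriharaPartialInfty W p f) :
    (∃ d : ℕ, kuriharaPartialDeepInfty W p f = d ∧ ((s + d : ℕ) : ℕ∞) ≤ kuriharaPartial W p f 0) ∧
      (∃ d : ℕ, kuriharaPartialDeepInfty W p f = d ∧ kuriharaPartial W p f 0 ≤ ((s + d : ℕ) : ℕ∞)) := by
  obtain ⟨d, hd, h0⟩ := hleaf
  have hdeep : kuriharaPartialDeepInfty W p f = d :=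
    le_antisymm (hS.trans hd.le) (hd.ge.trans (kuriharaPartialInfty_le_kuriharaPartialDeepInfty W p f))
  exact ⟨⟨d, hdeep, h0.ge⟩, ⟨d, hdeep, h0.le⟩⟩

/-- **Granted crux 19077 at the row, (19075 ∧ 19076) ⟺ leaf** (all at the row; `s` stands for
`ord_p #Ш(p)`). The `⟸` direction is the previous theorem; `⟹` is the Assembly's bookkeeping
(`∂^{(∞)} ≤ ∂^{(∞)}_{deep} ≤ ∂^{(∞)}`, antisymmetry in `ℕ∞`). [cite: Kim2025RefinedTNC, Thm 1.1, Thm 1.2] -/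
theorem deep_conclusions_iff_leaf_conclusion_of_shallowLeDeep {s : ℕ}
    (hS : kuriharaPartialDeepInfty W p f ≤ kuriharaPartialInfty W p f) :
    ((∃ d : ℕ, kuriharaPartialDeepInfty W p f = d ∧ ((s + d : ℕ) : ℕ∞) ≤ kuriharaPartial W p f 0) ∧
      (∃ d : ℕ, kuriharaPartialDeepInfty W p f = d ∧ kuriharaPartial W p f 0 ≤ ((s + d : ℕ) : ℕ∞))) ↔
    (∃ d : ℕ, kuriharaPartialInfty W p f = d ∧ kuriharaPartial W p f 0 = ((s + d : ℕ) : ℕ∞)) := by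
  constructor
  · rintro ⟨⟨d, hd, hU⟩, ⟨d', hd', hL⟩⟩
    have hdd : d' = d := by
      have : ((d' : ℕ) : ℕ∞) = (d : ℕ∞) := by rw [← hd', ← hd]
      exact_mod_cast this
    subst hdd
    have hall : kuriharaPartialInfty W p f = d' :=
      le_antisymm ((kuriharaPartialInfty_le_kuriharaPartialDeepInfty W p f).trans hd.le)
        (hd.ge.trans hS)
    exact ⟨d', hall, le_antisymm hL hU⟩
  · intro hleaf
    exact deep_conclusions_of_leaf_conclusion_of_shallowLeDeep W p f hleaf hS

end Row

/-! ### §2 Class level at `p = 3`: the `t = 0` rows -/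

/-- **Leaf ∧ crux 19077 ⟹ cruxes 19076 ∧ 19075 on every `t = 0` row.** Granted the leaf
`N11.KimAtThreeRankZeroPUB` (by name) and `ShallowEqDeepAtTorsionFree` (item 19077, by name): for
`W/ℚ` globally minimal with the `3`-adic tower onto, `#E(ℚ₃)[3] = 1`, `Ш(E/ℚ)` finite, `f` the newform
with `3`-integral plus symbols and `ord(δ̃) = 0`, BOTH `∂^{(∞)}_{deep} = d ∧ ord₃ #Ш(3) + d ≤ ∂⁽⁰⁾`
(19076's conclusion) and `∂⁽⁰⁾ ≤ ord₃ #Ш(3) + d` (19075's conclusion) hold. The converse of the route's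
Assembly on the `t = 0` locus. [cite: Kim2025RefinedTNC, Thm 1.1, Thm 1.2] [cite: MazurRubin2004, Def. 5.2.11] -/
theorem deepUpper_and_deepLower_of_kimAtThreeRankZeroPUB_of_shallowEqDeepAtTorsionFree
    (hleaf : N11.KimAtThreeRankZeroPUB) (hS : ShallowEqDeepAtTorsionFree) :
    ∀ (W : WeierstrassCurve ℚ) [W.IsElliptic] [W.IsGloballyMinimal],
      (∀ n : ℕ, W.HasSurjectiveModNGaloisRep (3 ^ n : ℕ)) →
      Nat.card {Q : (W.baseChange ℚ_[3]).toAffine.Point // (3 : ℕ) • Q = 0} = 1 →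
      Finite W.sha →
      ∀ {N : ℕ} [NeZero N] (f : CuspForm (Gamma0 N) 2), IsNewformOf W f →
      (∀ r : ℚ, ratPlusSymbol f r ≠ 0 → 0 ≤ padicValRat 3 (ratPlusSymbol f r)) →
      kuriharaVanishingOrder W 3 f = 0 →
        (∃ d : ℕ, kuriharaPartialDeepInfty W 3 f = d ∧
          ((padicValNat 3 (Nat.card (AddCommGroup.primaryComponent W.sha 3)) + d : ℕ) : ℕ∞) ≤
            kuriharaPartial W 3 f 0) ∧
        (∃ d : ℕ, kuriharaPartialDeepInfty W 3 f = d ∧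
          kuriharaPartial W 3 f 0 ≤
            ((padicValNat 3 (Nat.card (AddCommGroup.primaryComponent W.sha 3)) + d : ℕ) : ℕ∞)) := by
  intro W _ _ htower ht0 hfin N _ f hf hint hord
  exact deep_conclusions_of_leaf_conclusion_of_shallowLeDeep W 3 f
    (hleaf W htower ht0 hfin f hf hint hord) (hS W htower ht0 hfin f hf hint hord)

/-- **The same from the ANNOUNCED record** `Kim2025.thm11_kimShaLength_of_integralPeriod_OPEN`
(arXiv:2505.09121 Thm. 1.1, UNREFEREED — an explicit hypothesis by name, never a theorem of the tree)
and crux 19077: on every `t = 0` row the conclusions of cruxes 19076 and 19075 hold. So, were the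
announced theorem refereed AND crux 19077 proved, the two deep cruxes would be settled on the `t = 0`
locus; their `t ≥ 1` rows are untouched by the record. [claim: Kim2025RefinedTNC, status: under-review]
[cite: Kim2025RefinedTNC, Thm 1.1] -/
theorem deepUpper_and_deepLower_of_thm11_OPEN_of_shallowEqDeepAtTorsionFree
    (hO : thm11_kimShaLength_of_integralPeriod_OPEN) (hS : ShallowEqDeepAtTorsionFree) :
    ∀ (W : WeierstrassCurve ℚ) [W.IsElliptic] [W.IsGloballyMinimal],
      (∀ n : ℕ, W.HasSurjectiveModNGaloisRep (3 ^ n : ℕ)) →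
      Nat.card {Q : (W.baseChange ℚ_[3]).toAffine.Point // (3 : ℕ) • Q = 0} = 1 →
      Finite W.sha →
      ∀ {N : ℕ} [NeZero N] (f : CuspForm (Gamma0 N) 2), IsNewformOf W f →
      (∀ r : ℚ, ratPlusSymbol f r ≠ 0 → 0 ≤ padicValRat 3 (ratPlusSymbol f r)) →
      kuriharaVanishingOrder W 3 f = 0 →
        (∃ d : ℕ, kuriharaPartialDeepInfty W 3 f = d ∧
          ((padicValNat 3 (Nat.card (AddCommGroup.primaryComponent W.sha 3)) + d : ℕ) : ℕ∞) ≤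
            kuriharaPartial W 3 f 0) ∧
        (∃ d : ℕ, kuriharaPartialDeepInfty W 3 f = d ∧
          kuriharaPartial W 3 f 0 ≤
            ((padicValNat 3 (Nat.card (AddCommGroup.primaryComponent W.sha 3)) + d : ℕ) : ℕ∞)) :=
  deepUpper_and_deepLower_of_kimAtThreeRankZeroPUB_of_shallowEqDeepAtTorsionFree
    (N11.kimAtThreeRankZeroPUB_of_thm11_OPEN hO) hS

/-- **Hence on the `t = 0` locus the three cruxes and {leaf, 19077} are INTERCHANGEABLE**: granted
crux 19077, for every `t = 0` row of the route, (19075 ∧ 19076 at the row) ⟺ (leaf at the row).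
[cite: Kim2025RefinedTNC, Thm 1.1, Thm 1.2] -/
theorem deep_iff_leaf_on_torsionFree_of_shallowEqDeepAtTorsionFree (hS : ShallowEqDeepAtTorsionFree)
    (W : WeierstrassCurve ℚ) [W.IsElliptic] [W.IsGloballyMinimal]
    (htower : ∀ n : ℕ, W.HasSurjectiveModNGaloisRep (3 ^ n : ℕ))
    (ht0 : Nat.card {Q : (W.baseChange ℚ_[3]).toAffine.Point // (3 : ℕ) • Q = 0} = 1)
    (hfin : Finite W.sha) {N : ℕ} [NeZero N] (f : CuspForm (Gamma0 N) 2) (hf : IsNewformOf W f)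
    (hint : ∀ r : ℚ, ratPlusSymbol f r ≠ 0 → 0 ≤ padicValRat 3 (ratPlusSymbol f r))
    (hord : kuriharaVanishingOrder W 3 f = 0) :
    ((∃ d : ℕ, kuriharaPartialDeepInfty W 3 f = d ∧
        ((padicValNat 3 (Nat.card (AddCommGroup.primaryComponent W.sha 3)) + d : ℕ) : ℕ∞) ≤
          kuriharaPartial W 3 f 0) ∧
      (∃ d : ℕ, kuriharaPartialDeepInfty W 3 f = d ∧
        kuriharaPartial W 3 f 0 ≤
          ((padicValNat 3 (Nat.card (AddCommGroup.primaryComponent W.sha 3)) + d : ℕ) : ℕ∞))) ↔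
    (∃ d : ℕ, kuriharaPartialInfty W 3 f = d ∧
      kuriharaPartial W 3 f 0 =
        ((padicValNat 3 (Nat.card (AddCommGroup.primaryComponent W.sha 3)) + d : ℕ) : ℕ∞)) :=
  deep_conclusions_iff_leaf_conclusion_of_shallowLeDeep W 3 f (hS W htower ht0 hfin f hf hint hord)

end Summit.BirchSwinnertonDyer.BirchSwinnertonDyer.Theorems.KimAtThreeDeepUpperOfLeaf

end
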